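import Summits.MatrixMultiplication.OmegaCensus.STPP211Z2pow5Codes
import Summits.MatrixMultiplication.OmegaCensus.STPP211RoomLaw

/-!
# (2,1,1)⁶ in (ℤ/2)⁵ — the X-ROOM CERTIFICATE, part B2: the normal form is without loss of generality

Cell `pub-omega` (unit `pub-omega-stpp-1-g35`), topic `Summits/MatrixMultiplication/OmegaCensus`.
HONEST FRAMING (verbatim): lottery ticket; floor = certified bounds/negative ranges. Census STRUCTURE bookkeeping (B5, T1 column at `(ℤ/2)⁵`);
nothing here is a bound on `ω`.

**`exists_normalForm`: every `(2,1,1)⁶` STPP family `(A, B, C)` of `𝔽₂⁵` has the same `#roomX` (`T1Room.roomX = ⋃ⱼₗ ((Bⱼ − Cⱼ) + (C_l − A_l))`)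
as a TRANSLATION NORMAL FORM family `Aᵢ = {aᵢ, qᵢ}` (`enc aᵢ < enc qᵢ`), `Bᵢ = {0}`, `Cᵢ = {cᵢ}` whose `c`-code list is one of the four
representatives `T1Z2p5.reps`.** Moves (each preserves the STPP, the cards and `#roomX`, `STPP211RoomLaw`): per-member translation
(`Bᵢ ↦ {0}`), the global `C`-shift, injective homomorphisms, re-indexing. Normalisation: shift `c₀ ↦ 0`; for `j = 0 … 4`, while some `cᵢ`
has code `≥ 2ʲ`, apply the normal-form map `phi j cᵢ` (`STPP211Z2pow5Codes`: fixes the codes `< 2ʲ`, sends `cᵢ ↦ uⱼ`); the `c`-set is then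
`base d ∪ R`, `R ⊆ free d`, `#R = 5 − d`, `d ∈ {3,4,5}` (`d ≤ 2` is excluded by counting), and the kernel-checked certificate table
`certs_cover` carries it onto a representative set; finally sort the blocks by code and orient the pairs.

References: H. Cohn, R. Kleinberg, B. Szegedy, C. Umans, FOCS 2005 (arXiv:math/0511460), Def. 5.1.
-/

namespace Summit.MatrixMultiplication.OmegaCensus

namespace T1Z2p5

open Finset Literature.Computability.AlgebraicComplexity T1Room

/-! ## Normal-form states and the moves -/

/-- In `𝔽₂⁵` every element is its own inverse. -/
theorem add_self5' : ∀ x : G5, x + x = 0 := by decide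

/-- A family in translation normal form (`Bᵢ = {0}`, `Cᵢ = {cᵢ}`, `#Aᵢ = 2`) with `#roomX = n`. -/
structure NFState (n : ℕ) (A : Fin 6 → Finset G5) (c : Fin 6 → G5) : Prop where
  /-- the STPP -/
  stpp : IsSTPP A (fun _ => ({0} : Finset G5)) (fun i => {c i})
  /-- the cards -/
  card_two : ∀ i, (A i).card = 2
  /-- the size of the X-room set -/
  room : (roomX A (fun _ => ({0} : Finset G5)) (fun i => {c i})).card = n

namespace NFState

variable {n : ℕ} {A : Fin 6 → Finset G5} {c : Fin 6 → G5}

/-- The `c`'s of a normal-form state are distinct (word `(s − s) + (0 − 0) + (cᵢ − cⱼ) = 0`). -/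
theorem c_injective (h : NFState n A c) : Function.Injective c := by
  intro i j hij
  obtain ⟨s, hs⟩ : (A i).Nonempty := card_pos.1 (by rw [h.card_two i]; norm_num)
  have hw := h.stpp i j i s hs s hs 0 (mem_singleton_self _) 0 (mem_singleton_self _) (c j) (mem_singleton_self _)
    (c i) (mem_singleton_self _) (by rw [hij]; abel)
  exact hw.1

/-- MOVE 1: the global `C`-shift. -/
theorem shiftC (h : NFState n A c) (γ : G5) : NFState n A (fun i => c i + γ) := by
  have hst := h.stpp.shiftBC 0 γ
  have hrm := card_roomX_shiftBC A (fun _ => ({0} : Finset G5)) (fun i => {c i}) 0 γ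
  simp only [image_singleton, add_zero] at hst hrm
  exact ⟨hst, h.card_two, hrm.trans h.room⟩

/-- MOVE 2: an injective homomorphism. -/
theorem map (h : NFState n A c) (φ : G5 →+ G5) (hφ : Function.Injective φ) :
    NFState n (fun i => (A i).image φ) (fun i => φ (c i)) := by
  have hst := h.stpp.map_of_injective φ hφ
  have hrm := card_roomX_map A (fun _ => ({0} : Finset G5)) (fun i => {c i}) φ hφ
  simp only [image_singleton, map_zero] at hst hrm
  exact ⟨hst, fun i => by rw [card_image_of_injective _ hφ]; exact h.card_two i, hrm.trans h.room⟩

/-- MOVE 3: re-indexing by a bijection. -/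
theorem reindex (h : NFState n A c) (σ : Fin 6 ≃ Fin 6) : NFState n (fun i => A (σ i)) (fun i => c (σ i)) :=
  ⟨h.stpp.comp_of_injective σ σ.injective, fun i => h.card_two (σ i),
    (congrArg Finset.card (roomX_reindex A (fun _ => ({0} : Finset G5)) (fun i => {c i}) σ)).trans h.room⟩

end NFState

/-! ## From a family to a normal-form state -/

/-- STAGE 0: translate every member so that `Bᵢ = {0}`. -/
theorem nf_stage0 {A B C : Fin 6 → Finset G5} (hS : IsSTPP A B C) (hc : ∀ i, (A i).card = 2 ∧ (B i).card = 1 ∧ (C i).card = 1) :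
    ∃ A' c', NFState (roomX A B C).card A' c' := by
  have hb : ∀ i, ∃ b, B i = {b} := fun i => card_eq_one.1 (hc i).2.1
  have hc' : ∀ i, ∃ x, C i = {x} := fun i => card_eq_one.1 (hc i).2.2
  choose b hb using hb
  choose c₀ hc₀ using hc'
  have hst := hS.translate fun i => -b i
  have hrm := roomX_translate A B C fun i => -b i
  have hB : (fun i => (B i).image (· + -b i)) = fun _ => ({0} : Finset G5) := by
    funext i; rw [hb i, image_singleton, add_neg_cancel]
  have hC : (fun i => (C i).image (· + -b i)) = fun i => ({c₀ i + -b i} : Finset G5) := by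
    funext i; rw [hc₀ i, image_singleton]
  rw [hB, hC] at hst hrm
  exact ⟨_, _, hst, fun i => by rw [card_image_of_injective _ (add_left_injective _)]; exact (hc i).1, congrArg _ hrm⟩

/-! ## The GL normalisation of the `c`-codes -/

/-- The invariant after `j` successful steps: normal form, `u 0 … u (j−1)` and `0` among the `c`'s. -/
def Inv (n j : ℕ) (A : Fin 6 → Finset G5) (c : Fin 6 → G5) : Prop :=
  NFState n A c ∧ (∀ l < j, ∃ i, c i = u l) ∧ ∃ i, c i = 0

/-- ONE STEP: either every `cᵢ` already has code `< 2ʲ`, or a normal-form map produces the invariant for `j + 1`. -/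
theorem inv_step {n j : ℕ} (hj : j < 5) {A : Fin 6 → Finset G5} {c : Fin 6 → G5} (h : Inv n j A c) :
    (∀ i, enc (c i) < 2 ^ j) ∨ ∃ A' c', Inv n (j + 1) A' c' := by
  by_cases hex : ∃ i, 2 ^ j ≤ enc (c i)
  · right
    obtain ⟨i, hi⟩ := hex
    obtain ⟨hN, hu, i₀, hi₀⟩ := h
    refine ⟨_, _, hN.map (phi ⟨j, hj⟩ (c i)) (phi_injective _ _), fun l hl => ?_, i₀, by simp [hi₀]⟩
    rcases Nat.lt_succ_iff_lt_or_eq.1 hl with hl | rfl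
    · obtain ⟨i', hi'⟩ := hu l hl
      refine ⟨i', ?_⟩
      simp only [hi']
      exact phi_fix ⟨j, hj⟩ hi (by rw [enc_u l (by omega)]; exact Nat.pow_lt_pow_right (by norm_num) hl)
    · exact ⟨i, phi_self ⟨l, hj⟩ hi⟩
  · left
    intro i
    exact Nat.lt_of_not_le fun hle => hex ⟨i, hle⟩

/-- DESCENT: from the invariant at `j` reach some `d ≤ 5` with the invariant and all codes `< 2ᵈ`. -/
theorem inv_descend {n : ℕ} : ∀ (k j : ℕ), j + k = 5 → ∀ {A : Fin 6 → Finset G5} {c : Fin 6 → G5}, Inv n j A c →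
    ∃ d, d ≤ 5 ∧ ∃ A' c', Inv n d A' c' ∧ ∀ i, enc (c' i) < 2 ^ d
  | 0, j, hjk, A, c, h => ⟨5, le_rfl, A, c, by rw [show j = 5 by omega] at h; exact h, fun i => by
      have := enc_lt (c i); norm_num; exact this⟩
  | k + 1, j, hjk, A, c, h => by
      rcases inv_step (by omega) h with hall | ⟨A', c', h'⟩
      · exact ⟨j, by omega, A, c, h, hall⟩
      · exact inv_descend k (j + 1) (by omega) h'

/-! ## Reading the normal form off the certificate table -/

/-- Every certificate points at a representative, and representatives are six codes `< 32` without repetition (kernel check). -/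
theorem reps_ok : (∀ e ∈ certs, e.2.2 < reps.length) ∧ ∀ r ∈ reps, r.length = 6 ∧ r.Nodup ∧ ∀ x ∈ r, x < 32 := by
  decide

/-- The `c`-set of a state satisfying the invariant with all codes `< 2ᵈ` is `base d ∪ R` with `R ∈ (free d).powersetCard (5 − d)` and
`d ∈ {3, 4, 5}`. -/
theorem cset_shape {n d : ℕ} (hd : d ≤ 5) {A : Fin 6 → Finset G5} {c : Fin 6 → G5} (h : Inv n d A c) (hlt : ∀ i, enc (c i) < 2 ^ d) :
    d ∈ ({3, 4, 5} : Finset ℕ) ∧ ∃ R ∈ (free d).powersetCard (5 - d), univ.image c = base d ∪ R := by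
  obtain ⟨hN, hu, i₀, hi₀⟩ := h
  set T := univ.image c with hT
  have hTcard : T.card = 6 := by rw [hT, card_image_of_injective _ hN.c_injective, card_univ, Fintype.card_fin]
  have hTspan : T ⊆ span d := by
    intro x hx
    obtain ⟨i, _, rfl⟩ := mem_image.1 hx
    exact mem_filter.2 ⟨mem_univ _, hlt i⟩
  have hbase : base d ⊆ T := by
    intro x hx
    rw [base, mem_insert, mem_image] at hx
    rcases hx with rfl | ⟨l, hl, rfl⟩
    · exact mem_image.2 ⟨i₀, mem_univ _, hi₀⟩
    · obtain ⟨i, hi⟩ := hu l (mem_range.1 hl)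
      exact mem_image.2 ⟨i, mem_univ _, hi⟩
  have hd3 : 3 ≤ d := by
    by_contra hlt3
    have := (card_le_card hTspan).trans (card_span_le d (mem_range.2 (by omega)))
    omega
  have hdmem : d ∈ ({3, 4, 5} : Finset ℕ) := by
    simp only [mem_insert, mem_singleton]; omega
  refine ⟨hdmem, T \ base d, ?_, (union_sdiff_of_subset hbase).symm⟩
  rw [mem_powersetCard]
  refine ⟨sdiff_subset_sdiff hTspan le_rfl, ?_⟩
  rw [card_sdiff_of_subset hbase, hTcard, card_base d (mem_range.2 (by omega))]
  omega

/-! ## Sorting and orienting -/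

/-- If the `c`-set is a representative set, re-index so that the `c`-code list IS the representative. -/
theorem exists_sorted {n : ℕ} {A : Fin 6 → Finset G5} {c : Fin 6 → G5} (h : NFState n A c) {r : List ℕ} (hr : r ∈ reps)
    (hset : univ.image c = setOf r) : ∃ A' c', NFState n A' c' ∧ (List.ofFn fun i => enc (c' i)) = r := by
  obtain ⟨hlen, hnd, hlt⟩ := (reps_ok.2 r hr)
  have hget : ∀ i : Fin 6, ∃ j, c j = dec (r[i.val]'(by rw [hlen]; exact i.isLt)) := by
    intro i
    have : dec (r[i.val]'(by rw [hlen]; exact i.isLt)) ∈ univ.image c := by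
      rw [hset, setOf, List.mem_toFinset, List.mem_map]
      exact ⟨_, List.getElem_mem _, rfl⟩
    obtain ⟨j, _, hj⟩ := mem_image.1 this
    exact ⟨j, hj⟩
  choose σ hσ using hget
  have hσinj : Function.Injective σ := by
    intro i i' hii'
    have h1 := hσ i
    rw [hii', hσ i'] at h1
    have h2 := congrArg enc h1
    rw [enc_dec _ (hlt _ (List.getElem_mem _)), enc_dec _ (hlt _ (List.getElem_mem _))] at h2
    exact Fin.ext ((hnd.getElem_inj_iff).1 h2.symm)
  have hσbij : Function.Bijective σ := Finite.injective_iff_bijective.1 hσinj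
  refine ⟨_, _, h.reindex (Equiv.ofBijective σ hσbij), ?_⟩
  apply List.ext_getElem (by rw [List.length_ofFn, hlen])
  intro i h1 h2
  rw [List.getElem_ofFn]
  show enc (c (σ ⟨i, _⟩)) = r[i]
  rw [hσ, enc_dec _ (hlt _ (List.getElem_mem _))]

/-- Orient the pairs by code. -/
theorem exists_oriented {n : ℕ} {A : Fin 6 → Finset G5} {c : Fin 6 → G5} (h : NFState n A c) :
    ∃ a q : Fin 6 → G5, (∀ i, A i = {a i, q i}) ∧ ∀ i, enc (a i) < enc (q i) := by
  have hp : ∀ i, ∃ a q : G5, A i = {a, q} ∧ enc a < enc q := by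
    intro i
    obtain ⟨x, y, hxy, hA⟩ := card_eq_two.1 (h.card_two i)
    have hne : enc x ≠ enc y := fun e => hxy (enc_injective e)
    rcases Nat.lt_or_gt_of_ne hne with hlt | hgt
    · exact ⟨x, y, hA, hlt⟩
    · exact ⟨y, x, hA.trans (pair_comm _ _), hgt⟩
  choose a q haq using hp
  exact ⟨a, q, fun i => (haq i).1, fun i => (haq i).2⟩

/-! ## The normal form -/

/-- **THE NORMAL FORM IS WITHOUT LOSS OF GENERALITY.** Every STPP family of size pattern `(2,1,1)⁶` in `𝔽₂⁵` has the same `#roomX` as a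
translation-normal-form family `({aᵢ, qᵢ}, {0}, {cᵢ})` with `enc aᵢ < enc qᵢ` whose `c`-code list is one of the four representatives
`reps`. [cite: CohnKleinbergSzegedyUmans2005, Def. 5.1] -/
theorem exists_normalForm {A B C : Fin 6 → Finset G5} (hS : IsSTPP A B C)
    (hc : ∀ i, (A i).card = 2 ∧ (B i).card = 1 ∧ (C i).card = 1) :
    ∃ (a q c : Fin 6 → G5), IsSTPP (fun i => ({a i, q i} : Finset G5)) (fun _ => {0}) (fun i => {c i}) ∧
      (∀ i, enc (a i) < enc (q i)) ∧ (List.ofFn fun i => enc (c i)) ∈ reps ∧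
      (roomX (fun i => ({a i, q i} : Finset G5)) (fun _ => {0}) (fun i => {c i})).card = (roomX A B C).card := by
  -- stage 0 and the shift `c₀ ↦ 0`
  obtain ⟨A₀, c₀, h₀⟩ := nf_stage0 hS hc
  have h₁ := h₀.shiftC (c₀ 0)
  have hinv : Inv (roomX A B C).card 0 A₀ (fun i => c₀ i + c₀ 0) :=
    ⟨h₁, fun l hl => absurd hl (Nat.not_lt_zero _), 0, add_self5' _⟩
  -- the GL descent
  obtain ⟨d, hd, A₂, c₂, hinv₂, hlt⟩ := inv_descend 5 0 rfl hinv
  obtain ⟨hdmem, R, hR, hset⟩ := cset_shape hd hinv₂ hlt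
  -- the certificate
  obtain ⟨e, he, himg⟩ := certs_cover d hdmem R hR
  have h₃ := (hinv₂.1.shiftC (dec e.1)).map (lin e he) (lin_injective e he)
  have hset₃ : univ.image (fun i => lin e he (c₂ i + dec e.1)) = setOf (reps.getD e.2.2 []) := by
    rw [← himg, ← hset, image_image, image_image]; rfl
  have hr : reps.getD e.2.2 [] ∈ reps := by
    rw [List.getD_eq_getElem _ _ (reps_ok.1 e he)]; exact List.getElem_mem _
  -- sort and orient
  obtain ⟨A₄, c₄, h₄, hlist⟩ := exists_sorted h₃ hr hset₃
  obtain ⟨a, q, hA, haq⟩ := exists_oriented h₄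
  have hAe : A₄ = fun i => ({a i, q i} : Finset G5) := funext hA
  subst hAe
  exact ⟨a, q, c₄, h₄.stpp, haq, hlist ▸ hr, h₄.room⟩

end T1Z2p5

end Summit.MatrixMultiplication.OmegaCensus
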